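import Literature.Analysis.FluidPDE.TaoLocalisationContinuation
import Literature.Analysis.FluidPDE.TaoH1AlmostRegular
import Literature.Analysis.FluidPDE.LerayH1Continuation
import Literature.Analysis.FluidPDE.TaoAnnulusAssembly
import HarnessLib

/-!
# Tao (2011/2013), Cor. 11.1 (bounded enstrophy) by continuation from the local `H¹` theory:
# Prop. 9.1 eliminated from the trust base of `tao2011_boundedEnstrophy(_unit)`

`Literature.Analysis.FluidPDE.tao2011_boundedEnstrophy_unit` (`TaoUnitViscosity.lean`; Tao 2011,
Cor. 11.1 = arXiv:1108.1165 Cor. 68, `ν = 1`, `f = 0`: a finite energy classical solution of the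
Navier–Stokes system on the **closed** slab `[0, T] × ℝ³` whose datum has `∇u(0) ∈ L²` lies in
`X¹([0, T] × ℝ³) = L^∞_t H¹_x ∩ L²_t H²_x`) is reduced in the tree, along the printed proof, to
Lemma 8.1 (proved), the Fourier step (proved), the §10 a priori enstrophy localisation (after
`TaoAnnulusAssembly.lean`: the single named fact `tao2011_nonlinearEstimate`, the estimate for
`Y₆`) **and** Prop. 9.1, the bounded total speed `‖u‖_{L¹_t L^∞_x} ≲ E^{1/2}T^{1/4} + E` for
Tao's general finite energy class (leaf `tao2011_duhamelNonlinearSpeed_unit`, the Littlewood–Paley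
analysis of the Duhamel formula, §9).

This file gives a second route which **does not use Prop. 9.1**: it proves

* `tao2011_boundedEnstrophy_of_almostRegular_of_apriori :
    tao2011_H1_local_almost_regular → tao2011_enstrophyLocalisation_exterior_apriori →
    tao2011_boundedEnstrophy`,

and hence (`TaoUnitViscosity`, `TaoEnstrophyLocalisationAnnulus`, `TaoAnnulusAssembly`)

* `tao2011_boundedEnstrophy_unit_of_almostRegular_of_nonlinearEstimate :
    tao2011_H1_local_almost_regular → tao2011_nonlinearEstimate → tao2011_boundedEnstrophy_unit`,

together with the same for the composite `tao2011_hasBoundedSobolevNormsOn` and for the three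
vendored forms of Cor. 11.4. Here `tao2011_H1_local_almost_regular` (`TaoH1AlmostRegular.lean`) is
Tao's **Thm. 5.4 (i)–(ii) with Prop. 5.6** (arXiv Thm. 31 and Prop. 33, pp. 18–19): from
divergence-free `H¹` data, a Leray–Hopf solution on a time interval of length `cν³/‖u₀‖⁴_{H¹}`,
`H¹`-continuous, and represented on every `[τ, T']`, `τ > 0`, by a classical solution with all
Sobolev norms bounded — the standard local `H¹` theory (also the smoothing leaf of the
Ladyzhenskaya–Prodi–Serrin programme `NSSerrinRegularity`), in place of the paper-specific
harmonic analysis of Prop. 9.1. It is the `H¹`-data analogue of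
`TaoLocalisationContinuation.lean`, which did the same for the Schwartz-data composite
`tao2011_hasBoundedSobolevNormsOn` using Thm. 5.4 (ii)+(iv) (`tao2011_smooth_local_existence`).

## The argument (a restart induction; every other ingredient is a theorem of the tree)

With `H¹` (rather than `H^∞`) data the solution is never strong up to `t = 0`, so the induction
propagates *strongness away from zero*, `Q(s)`: `u ∈ L^∞_t H^k_x([ε, s] × ℝ³)` for all `k` and
all `0 < ε < s`.

0. **Total speed from strongness away from zero**
   (`lintegral_eLpNorm_top_le_of_forall_hasBoundedSobolevNormsOn`): the proved
   Foias–Guillopé–Temam/Agmon bound `tao2011_boundedTotalSpeed_of_hasBoundedSobolevNormsOn`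
   (`NSStrongSpeedBound.lean`) applied to the translates `u(· + ε)` on `[0, T − ε]` and `ε → 0`
   (monotone convergence) gives `∫₀^{T'}‖u‖_∞ ≤ K(ν^{-3/4}E^{1/2}T'^{1/4} + ν⁻²E)` whenever
   `Q(T')`, using only the dissipation bound of Lemma 8.1 — uniform in `T'`.
1. **Uniform `H¹` bound** (`exists_uniform_gradient_bound_of_forall`, the proof of
   `exists_uniform_gradient_bound` verbatim with step 0 as the speed input): fix the energy class
   (Lemma 8.1, proved: `energyClass_of_finiteEnergy`), the speed budget `M`, then `δ` ((10.2) for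
   `T`), `r > C(E + M + δ⁻²)` and `R > 2r` with `∫_{|x|>R}|ω₀|² ≤ δ²`; if `Q(T')` the a priori
   Thm. 10.1 on `[0, T']` bounds the exterior enstrophy, joint smoothness on
   `[0, T] × B̄(0, R + r)` the interior one, and the proved Fourier step
   (`tao2011_sobolev_of_vorticity_holds`) gives `∫‖Du(t)‖² ≤ H` for `t ≤ T'`, with `H`
   **independent of `T'`**.
2. **Restart** (`hasBoundedSobolevNormsOn_Icc_restart_of_almostRegular`). If
   `‖u(s)‖²_{L²} + ‖∇u(s)‖²_{L²} ≤ A` (`0 ≤ s < T`), then `u(s)` is an `H¹` datum (smooth, so its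
   classical gradient is its weak gradient; weakly divergence free), the fact yields a Leray–Hopf
   solution `v` on `[0, τ')`, `τ' = min(cν³/(A²+1), T − s)`, `H¹`-continuous, hence in the Serrin
   class `L^∞_t L⁶_x` (`memLqLp_top_six_of_isH1RegularOn_Icc`, `H¹ ⊂ L⁶`), and represented on
   `[τ₁, τ']` by a strong classical `w`; the translate `u(· + s)` is a Leray–Hopf solution from the
   same datum (`isLerayHopfOn_translate_of_finiteEnergy`, Lemma 4.1 (i) + Lemma 8.1, proved);
   the proved Prodi–Serrin theorem (`serrin_weak_strong_uniqueness_holds`) gives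
   `u(t + s) = v(t) = w(t)` a.e., hence everywhere (continuous slices), so `u` is strong on
   `[s + τ₁, s + τ']` for every `τ₁ > 0`.
3. **Induction** (`forall_hasBoundedSobolevNormsOn_Icc_of_almostRegular_of_apriori`): with
   `A = sup_t∫|u|² + 3H + ∫|∇u₀|²` fixed by step 1, restarting at `s' = max(s − τ/2, 0)` advances
   `Q(s)` to `Q(min(s + τ/2, T))` (the new strong segment overlaps the old ones); `Q(0)` is
   vacuous; after `⌈2T/τ⌉` steps `Q(T)` holds and step 1 gives `sup_{[0,T]}∫‖Du‖² ≤ H`.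
4. **`∇²u ∈ L²_{t,x}`** (`lintegral_Ioo_iteratedFDeriv_two_lt_top_of_forall`): on each
   `[ε, T]` the proved FGT normalised-enstrophy estimate `StrongData.fgt_dissipation`
   (`ν∫ z/(1+y)² ≤ 1 + C_Yν⁻³∫ y`, `y = ∫|Ω|² ≤ 36H`, `∫ y ≤ 4E/ν`) bounds `∫_ε^T∫|∇Ω|²`
   independently of `ε`; the global div–curl bound `∫|∇²u|² ≤ ∫|∇Ω|²`
   (`integral_levelSq_succ_le_integral_vortSq`), `‖D²u‖² ≤ 27|∇²u|²` and `ε → 0` conclude.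
   Steps 3–4 give `MemSobolevX 1 T u` (`memSobolevX_of_almostRegular_of_apriori`).

As Tao stresses (Remark 11.2) the closedness of the slab is essential; it enters through the
interior bound of step 1. No statement of the tree is modified; no definition is introduced.

## Mathlib / tree search

`lean search 'boundedEnstrophy_of|almostRegular|restart'` (FluidPDE): the continuation device
exists for Schwartz data (`TaoLocalisationContinuation`: `exists_uniform_gradient_bound`,
`hasBoundedSobolevNormsOn_restart`) and for Leray–Hopf `H¹`-regularity
(`LerayH1Continuation.isH1RegularOn_Icc_step`, from the named fact `leray_local_strong_H1`, RRS
Thm. 6.15, which records no smoothing and no `L²_t H²_x`); nothing derived Cor. 11.1 for `H¹` data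
without Prop. 9.1. Tree theorems used: `tao2011_boundedTotalSpeed_of_hasBoundedSobolevNormsOn`,
`IsClassicalNSSolutionOn.nonempty_strongData`, `StrongData.fgt_dissipation`,
`StrongData.integral_enstrophyAt_le`, `integral_levelSq_succ_le_integral_vortSq`
(`NSStrongSpeedBound`); `integrable_levelSq_of_lintegral_lt_top`,
`lintegral_sq_norm_iteratedFDeriv_le`, `tao2011_hasBoundedSobolevNormsOn_of_boundedEnstrophy`
(`NSEnstrophyPersistence`); `energyClass_of_finiteEnergy`, `isLerayHopfOn_translate_of_finiteEnergy`,
`memLp_two_of_lintegral_lt_top` (`TaoFiniteEnergyLerayHopf`); `serrin_weak_strong_uniqueness_holds`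
(`NSSerrinUniqueness`); `memLqLp_top_six_of_isH1RegularOn_Icc` (`LerayH1Continuation`);
`eH1NormSq_le_of_hasWeakGradient` (`CheskidovShvydkoyRegular`), `hasWeakGradient_fderiv_of_contDiff`
(`WholeSpaceIBP`), `IsLerayHopfOn.isWeaklyDivFree_datum`; `tao2011_sobolev_of_vorticity_holds`,
`exists_setLIntegral_compl_ball_le`, `setLIntegral_ball_enorm_sq_le`, `lintegral_curl_sq_le`,
`lintegral_frobeniusNormSq_le_three_mul_iteratedFDeriv_one` (`TaoEnstrophyLocalisationProofs`,
`TaoLocalisationContinuation`); `IsClassicalNSSolutionOn.comp_add_right` (`ClassicalSolutionGlue`),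
`setLIntegral_Ioo_comp_add_right` (`LerayHopfTranslate`); the assemblies of `TaoUnitViscosity`,
`TaoEnstrophyLocalisationAnnulus`, `TaoAnnulusAssembly`, `NSVelocityUniqueness`. Mathlib:
`setLIntegral_iUnion_of_directed` (monotone convergence in `ε`), `setIntegral_mono_on`,
`ofReal_integral_eq_lintegral_ofReal`, `Continuous.ae_eq_iff_eq`, `Real.rpow_le_rpow`,
`exists_nat_ge`, `exists_nat_gt`.

## References

* T. Tao, *Localisation and compactness properties of the Navier–Stokes global regularity
  problem*, Anal. PDE 6 (2013) 25–107 = arXiv:1108.1165 (`Tao2011`): Cor. 11.1 and its proof,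
  Remark 11.2 (held arXiv text: Corollary 68, Remark 69, p. 36), Thm. 5.4 (i)–(ii) and Prop. 5.6
  (Thm. 31, Lemma 32, Prop. 33, pp. 18–19), Thm. 10.1 and Remark 10.6 (Thm. 59, Rem. 64,
  pp. 30–33), Prop. 9.1 (Prop. 52, p. 27), Lemma 8.1 (Lemma 44), Cor. 11.4 and Remark 11.3
  (Cor. 71, Rem. 70, p. 36).
* J. C. Robinson, J. L. Rodrigo, W. Sadowski, *The Three-Dimensional Navier–Stokes Equations*,
  CUP 2016 (`RobinsonRodrigoSadowski2016`): proof of Lemma 6.11 (restart from `u(t)` with a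
  local strong solution, weak–strong uniqueness), Thm. 8.19 (weak–strong uniqueness), Lemma 8.15 +
  Thm. 8.17 (the normalised-enstrophy estimate and the strong-class `L¹_t L^∞_x` bound).
* J. Leray, Acta Math. 63 (1934) (`Leray1934`), §§19–22 (the restart/continuation argument).
-/

noncomputable section

open MeasureTheory Set Function Filter Topology
open scoped ENNReal NNReal ContDiff

namespace Literature.Analysis.FluidPDE

/-! ## Step 0: bounded total speed from strongness on every `[ε, T]` -/

/-- `(0, T) = ⋃ₙ (T/(n+2), T)`. [folklore] -/
theorem iUnion_Ioo_div_nat_add_two {T : ℝ} (hT : 0 < T) :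
    (⋃ n : ℕ, Ioo (T / ((n : ℝ) + 2)) T) = Ioo 0 T := by
  ext t
  simp only [mem_iUnion, mem_Ioo]
  constructor
  · rintro ⟨n, h1, h2⟩
    exact ⟨lt_trans (by positivity) h1, h2⟩
  · rintro ⟨h1, h2⟩
    obtain ⟨n, hn⟩ := exists_nat_gt (T / t)
    refine ⟨n, ?_, h2⟩
    rw [div_lt_iff₀ (by positivity)]
    rw [div_lt_iff₀ h1] at hn
    nlinarith

/-- The family `(T/(n+2), T)` is directed by inclusion. [folklore] -/
theorem directed_Ioo_div_nat_add_two {T : ℝ} (hT : 0 < T) :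
    Directed (· ⊆ ·) fun n : ℕ => Ioo (T / ((n : ℝ) + 2)) T := by
  refine Monotone.directed_le fun a b hab => Ioo_subset_Ioo_left ?_
  exact div_le_div_of_nonneg_left hT.le (by positivity) (by exact_mod_cast Nat.add_le_add_right hab 2)

/-- **Bounded total speed for solutions that are strong away from `t = 0`.** The proved
strong-class total speed bound (`tao2011_boundedTotalSpeed_of_hasBoundedSobolevNormsOn`:
Foias–Guillopé–Temam / Agmon, Robinson–Rodrigo–Sadowski 2016, Lemma 8.15 + Thm. 8.17; the bound
printed in Tao 2011, Prop. 9.1) extends verbatim to classical solutions on `[0, T] × ℝ³` that have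
all Sobolev norms bounded on `[ε, T]` for every `ε > 0` (but possibly not up to `t = 0`): apply it
to the translates `u(· + ε)` on `[0, T - ε]`, whose dissipation is at most that of `u`, and let
`ε → 0` by monotone convergence; the constant is unchanged. [cite: RobinsonRodrigoSadowski2016, Lemma 8.15 + Thm. 8.17; Tao2011, Prop. 9.1 (statement)] -/
theorem lintegral_eLpNorm_top_le_of_forall_hasBoundedSobolevNormsOn :
    ∃ K : ℝ, 0 < K ∧
      ∀ ⦃ν : ℝ⦄ (_hν : 0 < ν) ⦃T : ℝ⦄ (_hT : 0 < T)
        ⦃u : ℝ → EuclideanSpace ℝ (Fin 3) → EuclideanSpace ℝ (Fin 3)⦄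
        ⦃p : ℝ → EuclideanSpace ℝ (Fin 3) → ℝ⦄
        (_hsol : IsClassicalNSSolutionOn (Icc 0 T) ν 0 u p)
        (_hHB : ∀ ε ∈ Ioo 0 T, HasBoundedSobolevNormsOn (Icc ε T) u)
        ⦃E : ℝ⦄ (_hE : 0 < E)
        (_hD : ENNReal.ofReal ν *
            ∫⁻ t in Ioo 0 T, ∫⁻ x, ENNReal.ofReal (frobeniusNormSq (fderiv ℝ (u t) x)) ≤
          ENNReal.ofReal E),
        ∫⁻ t in Ioo 0 T, eLpNorm (u t) ∞ volume ≤
          ENNReal.ofReal (K * (ν ^ (-(3 / 4 : ℝ)) * Real.sqrt E * T ^ (1 / 4 : ℝ) + ν⁻¹ ^ 2 * E)) := by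
  obtain ⟨K, hK, h⟩ := tao2011_boundedTotalSpeed_of_hasBoundedSobolevNormsOn
  refine ⟨K, hK, fun ν hν T hT u p hsol hHB E hE hD => ?_⟩
  have hstep : ∀ ε ∈ Ioo 0 T, ∫⁻ t in Ioo ε T, eLpNorm (u t) ∞ volume ≤
      ENNReal.ofReal (K * (ν ^ (-(3 / 4 : ℝ)) * Real.sqrt E * T ^ (1 / 4 : ℝ) + ν⁻¹ ^ 2 * E)) := by
    intro ε hε
    have hTε : 0 < T - ε := by linarith [hε.2]
    have hsol' : IsClassicalNSSolutionOn (Icc 0 (T - ε)) ν 0 (fun t => u (t + ε))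
        (fun t => p (t + ε)) :=
      (hsol.comp_add_right ε).mono (fun t ht => ⟨by linarith [ht.1, hε.1], by linarith [ht.2]⟩)
        (uniqueDiffOn_Icc hTε)
    have hHB' : HasBoundedSobolevNormsOn (Icc 0 (T - ε)) (fun t => u (t + ε)) := fun n => by
      obtain ⟨C, hC⟩ := hHB ε hε n
      exact ⟨C, fun t ht => hC (t + ε) ⟨by linarith [ht.1], by linarith [ht.2]⟩⟩
    have htr : ∀ g : ℝ → ℝ≥0∞, ∫⁻ t in Ioo 0 (T - ε), g (t + ε) = ∫⁻ t in Ioo ε T, g t :=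
      fun g => by rw [setLIntegral_Ioo_comp_add_right g 0 (T - ε) ε, zero_add, sub_add_cancel]
    have hD' : ENNReal.ofReal ν *
        ∫⁻ t in Ioo 0 (T - ε), ∫⁻ x,
          ENNReal.ofReal (frobeniusNormSq (fderiv ℝ (u (t + ε)) x)) ≤ ENNReal.ofReal E := by
      rw [htr (fun t => ∫⁻ x, ENNReal.ofReal (frobeniusNormSq (fderiv ℝ (u t) x)))]
      exact (mul_le_mul_right (lintegral_mono_set (Ioo_subset_Ioo_left hε.1.le)) _).trans hD
    have key := h hν hTε hsol' hHB' hE hD'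
    rw [htr (fun t => eLpNorm (u t) ∞ volume)] at key
    refine key.trans (ENNReal.ofReal_le_ofReal (mul_le_mul_of_nonneg_left ?_ hK.le))
    have h14 : (T - ε) ^ (1 / 4 : ℝ) ≤ T ^ (1 / 4 : ℝ) :=
      Real.rpow_le_rpow hTε.le (by linarith [hε.1]) (by norm_num)
    have hν34 : 0 ≤ ν ^ (-(3 / 4 : ℝ)) := Real.rpow_nonneg hν.le _
    have := mul_le_mul_of_nonneg_left h14 (mul_nonneg hν34 (Real.sqrt_nonneg E))
    linarith
  rw [← iUnion_Ioo_div_nat_add_two hT, setLIntegral_iUnion_of_directed _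
    (directed_Ioo_div_nat_add_two hT)]
  exact iSup_le fun n => hstep _ ⟨by positivity, div_lt_self hT (by linarith)⟩

/-! ## Step 1: a uniform `H¹` bound on initial segments that are strong away from `t = 0` -/

/-- **Uniform gradient bound on initial segments strong away from zero** (the rôle of Cor. 11.1
in the continuation argument; compare `exists_uniform_gradient_bound`, where the segments are
strong up to `t = 0`). Let `(u, p)` be a finite energy classical solution on the closed slab
`[0, T] × ℝ³` with `∇u(0) ∈ L²`, and assume the a priori form of Tao's Thm. 10.1
(`tao2011_enstrophyLocalisation_exterior_apriori`). Then there is `H < ∞` such that for every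
`0 < T' ≤ T` for which `u ∈ L^∞_t H^k_x([ε, T'] × ℝ³)` for all `k` and all `0 < ε < T'`, one has
`∫‖Du(t)‖² ≤ H` for all `t ∈ [0, T']`. Proof: the total speed bound
`lintegral_eLpNorm_top_le_of_forall_hasBoundedSobolevNormsOn` (with the dissipation bound of
Lemma 8.1 on `[0, T]`) supplies the hypothesis `∫₀^{T'}‖u‖_∞ ≤ M` of the a priori Thm. 10.1 with
`M` independent of `T'`; `δ`, `r`, `R` are chosen for `[0, T]` (exterior initial enstrophy `≤ δ²`
by monotone convergence, as in Tao's proof of Cor. 11.1); exterior enstrophy from Thm. 10.1,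
interior enstrophy from joint smoothness on `[0, T] × B̄(0, R + r)`, and `∫‖Du‖² ≲ ∫|ω|²` by the
proved Fourier step. [cite: Tao2011, Cor. 11.1 (proof) + Thm. 10.1 + Prop. 9.1] -/
theorem exists_uniform_gradient_bound_of_forall
    (hA : tao2011_enstrophyLocalisation_exterior_apriori)
    {ν T : ℝ} (hν : 0 < ν) (hT : 0 < T)
    {u : ℝ → EuclideanSpace ℝ (Fin 3) → EuclideanSpace ℝ (Fin 3)}
    {p : ℝ → EuclideanSpace ℝ (Fin 3) → ℝ}
    (hsol : IsClassicalNSSolutionOn (Icc 0 T) ν 0 u p)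
    (hfe : ∃ C : ℝ≥0∞, C < ⊤ ∧ ∀ t ∈ Icc 0 T, ∫⁻ x, ‖u t x‖ₑ ^ 2 ≤ C)
    (h₁ : ∫⁻ x, ‖iteratedFDeriv ℝ 1 (u 0) x‖ₑ ^ 2 < ⊤) :
    ∃ H : ℝ≥0∞, H < ⊤ ∧ ∀ ⦃T' : ℝ⦄, 0 < T' → T' ≤ T →
      (∀ ε ∈ Ioo 0 T', HasBoundedSobolevNormsOn (Icc ε T') u) →
      ∀ t ∈ Icc 0 T', ∫⁻ x, ‖iteratedFDeriv ℝ 1 (u t) x‖ₑ ^ 2 ≤ H := by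
  obtain ⟨K, hK⟩ := tao2011_sobolev_of_vorticity_holds
  obtain ⟨KS, hKS, hspeed⟩ := lintegral_eLpNorm_top_le_of_forall_hasBoundedSobolevNormsOn
  obtain ⟨c, C, A, hc, hC, hApos, hmain⟩ := hA hν
  have hsm : FluidPDE.IsSmoothSpaceTimeOn (Icc 0 T) u := hsol.smooth_velocity
  have hUD : UniqueDiffOn ℝ (Icc 0 T) := uniqueDiffOn_Icc hT
  have hu : ∀ t ∈ Icc 0 T, ContDiff ℝ ∞ (u t) := fun t ht => hsol.contDiff_velocity ht
  -- the energy class (Lemma 8.1), with a real parameter `E > 0`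
  obtain ⟨A₀, hA₀, hEt, hD, -⟩ := energyClass_of_finiteEnergy hsol hν hT hfe
  have hL2 : ∀ t ∈ Icc 0 T, ∫⁻ x, ‖u t x‖ₑ ^ 2 < ⊤ := fun t ht =>
    (hEt t ht).trans_lt (lt_top_iff_ne_top.2 hA₀)
  set E : ℝ := A₀.toReal + 1 with hEdef
  have hEpos : 0 < E := by positivity
  have hA₀E : A₀ ≤ ENNReal.ofReal E := by
    rw [hEdef, ENNReal.ofReal_add ENNReal.toReal_nonneg zero_le_one, ENNReal.ofReal_toReal hA₀]
    exact le_self_add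
  have hE2 : ENNReal.ofReal E ≤ ENNReal.ofReal (2 * E) := ENNReal.ofReal_le_ofReal (by linarith)
  have hEt' : ∀ t ∈ Icc 0 T, ∫⁻ x, ‖u t x‖ₑ ^ 2 ≤ ENNReal.ofReal (2 * E) := fun t ht =>
    (hEt t ht).trans (hA₀E.trans hE2)
  have hD' : ENNReal.ofReal ν *
      ∫⁻ t in Ioo 0 T, ∫⁻ x, ENNReal.ofReal (frobeniusNormSq (fderiv ℝ (u t) x)) ≤
        ENNReal.ofReal E := hD.trans hA₀E
  -- the total speed budget `M` (uniform in `T' ≤ T`)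
  have hν34 : 0 ≤ ν ^ (-(3 / 4 : ℝ)) := Real.rpow_nonneg hν.le _
  have hT14 : 0 ≤ T ^ (1 / 4 : ℝ) := Real.rpow_nonneg hT.le _
  set M : ℝ := KS * (ν ^ (-(3 / 4 : ℝ)) * Real.sqrt E * T ^ (1 / 4 : ℝ) + ν⁻¹ ^ 2 * E) with hMdef
  have hM0 : 0 ≤ M := by positivity
  -- the choice of `δ` (condition (10.2) on `[0, T]`)
  set δ : ℝ := min 1 (c / (T * (1 + Real.sqrt E))) with hδdef
  have hden : 0 < T * (1 + Real.sqrt E) := by positivity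
  have hδpos : 0 < δ := lt_min one_pos (div_pos hc hden)
  have hδ1 : δ ≤ 1 := min_le_left _ _
  have hsmall : δ ^ 4 * T + δ ^ 5 * Real.sqrt E * T ≤ c := by
    have h4 : δ ^ 4 ≤ δ := pow_le_of_le_one hδpos.le hδ1 (by norm_num)
    have h5 : δ ^ 5 ≤ δ := pow_le_of_le_one hδpos.le hδ1 (by norm_num)
    have hsq : 0 ≤ Real.sqrt E := Real.sqrt_nonneg _
    calc δ ^ 4 * T + δ ^ 5 * Real.sqrt E * T ≤ δ * T + δ * Real.sqrt E * T := by gcongr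
      _ = δ * (T * (1 + Real.sqrt E)) := by ring
      _ ≤ c / (T * (1 + Real.sqrt E)) * (T * (1 + Real.sqrt E)) := by
          gcongr; exact min_le_right _ _
      _ = c := div_mul_cancel₀ _ hden.ne'
  -- the choice of `r` (condition (10.3) in the a priori form)
  set r : ℝ := C * (E + M + δ⁻¹ ^ 2) + 1 with hrdef
  have hlarge : C * (E + M + δ⁻¹ ^ 2) < r := lt_add_one _
  have hrpos : 0 < r := by
    have : 0 ≤ C * (E + M + δ⁻¹ ^ 2) := by positivity
    linarith
  -- the choice of `R`: small exterior initial enstrophy (monotone convergence)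
  have hcurl0 : ∫⁻ x, ‖FluidPDE.curl (u 0) x‖ₑ ^ 2 < ⊤ :=
    (lintegral_curl_sq_le (u 0)).trans_lt (ENNReal.mul_lt_top ENNReal.ofReal_lt_top h₁)
  have hδ2 : (0 : ℝ≥0∞) < ENNReal.ofReal (δ ^ 2) := ENNReal.ofReal_pos.2 (by positivity)
  obtain ⟨R, hR2r, hω₀⟩ := exists_setLIntegral_compl_ball_le hcurl0 hδ2 (2 * r)
  have hrR : r < R / 2 := by linarith
  -- interior bound from joint smoothness on `[0, T] × B̄(0, R + r)`
  set ρ : ℝ := R + r with hρ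
  obtain ⟨M₁, hM₁⟩ := hsm.exists_bound_iteratedFDeriv isCompact_Icc hUD
    (isCompact_closedBall (0 : EuclideanSpace ℝ (Fin 3)) ρ) 1
  set κ : ℝ := ‖FluidPDE.curlCLM‖ with hκ
  have hκ0 : 0 ≤ κ := by rw [hκ]; exact norm_nonneg FluidPDE.curlCLM
  have hcurl_pt : ∀ t ∈ Icc 0 T, ∀ x ∈ Metric.closedBall (0 : EuclideanSpace ℝ (Fin 3)) ρ,
      ‖FluidPDE.curl (u t) x‖ ≤ κ * M₁ := by
    intro t ht x hx
    refine (FluidPDE.norm_curl_le (u t) x).trans ?_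
    rw [← norm_iteratedFDeriv_one]
    exact mul_le_mul_of_nonneg_left (hM₁ t ht x hx) hκ0
  have hvol : volume (Metric.ball (0 : EuclideanSpace ℝ (Fin 3)) ρ) < ⊤ := measure_ball_lt_top
  set W₁ : ℝ≥0∞ :=
    ENNReal.ofReal ((κ * M₁) ^ 2) * volume (Metric.ball (0 : EuclideanSpace ℝ (Fin 3)) ρ) +
      ENNReal.ofReal ((A * δ) ^ 2) with hW₁
  have hW₁top : W₁ < ⊤ :=
    ENNReal.add_lt_top.2 ⟨ENNReal.mul_lt_top ENNReal.ofReal_lt_top hvol, ENNReal.ofReal_lt_top⟩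
  refine ⟨(K : ℝ≥0∞) * W₁, ENNReal.mul_lt_top ENNReal.coe_lt_top hW₁top, ?_⟩
  -- now an initial segment `[0, T']`, strong on every `[ε, T']`
  intro T' hT' hT'T hHB t ht
  have hsub : Icc 0 T' ⊆ Icc 0 T := Icc_subset_Icc_right hT'T
  have hsol' : IsClassicalNSSolutionOn (Icc 0 T') ν 0 u p := hsol.mono hsub (uniqueDiffOn_Icc hT')
  -- dissipation on `[0, T']`
  have hD'' : ENNReal.ofReal ν *
      ∫⁻ t in Ioo 0 T', ∫⁻ x, ENNReal.ofReal (frobeniusNormSq (fderiv ℝ (u t) x)) ≤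
        ENNReal.ofReal E :=
    (mul_le_mul_right (lintegral_mono_set (Ioo_subset_Ioo_right hT'T)) _).trans hD'
  -- bounded total speed on `[0, T']`, within the budget `M`
  have hMt : ∫⁻ t in Ioo 0 T', eLpNorm (u t) ∞ volume ≤ ENNReal.ofReal M := by
    refine (hspeed hν hT' hsol' hHB hEpos hD'').trans (ENNReal.ofReal_le_ofReal ?_)
    have h14 : T' ^ (1 / 4 : ℝ) ≤ T ^ (1 / 4 : ℝ) :=
      Real.rpow_le_rpow hT'.le hT'T (by norm_num)
    have hmon : ν ^ (-(3 / 4 : ℝ)) * Real.sqrt E * T' ^ (1 / 4 : ℝ) ≤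
        ν ^ (-(3 / 4 : ℝ)) * Real.sqrt E * T ^ (1 / 4 : ℝ) :=
      mul_le_mul_of_nonneg_left h14 (by positivity)
    rw [hMdef]
    exact mul_le_mul_of_nonneg_left (by linarith) hKS.le
  -- Thm. 10.1 (a priori form) on `[0, T']`
  have hsmall' : δ ^ 4 * T' + δ ^ 5 * Real.sqrt E * T' ≤ c := by
    refine le_trans ?_ hsmall
    have hsq : 0 ≤ Real.sqrt E := Real.sqrt_nonneg _
    gcongr
  obtain ⟨hext1, -⟩ := hmain hT' hsol' hEpos.le hM0 (fun s hs => hEt' s (hsub hs)) hD'' hMt 0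
    hδpos hrpos hrR hω₀ hsmall' hlarge
  -- gluing interior and exterior enstrophy at time `t`
  have hω : ∫⁻ x, ‖FluidPDE.curl (u t) x‖ₑ ^ 2 ≤ W₁ := by
    rw [← lintegral_add_compl _ (measurableSet_ball (x := (0 : EuclideanSpace ℝ (Fin 3))) (ε := ρ))]
    exact add_le_add (setLIntegral_ball_enorm_sq_le (hcurl_pt t (hsub ht))) (hext1 t ht)
  -- Fourier step
  exact ((hK (hu t (hsub ht)) (hsol.divFree t (hsub ht)) (hL2 t (hsub ht))).1).trans
    (mul_le_mul_right hω _)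

/-! ## Step 2: the restart (Thm. 5.4 (i)–(ii) + Prop. 5.6 local solution, weak–strong uniqueness) -/

/-- Bounded Sobolev norms on two time sets give bounded Sobolev norms on their union. [folklore] -/
theorem HasBoundedSobolevNormsOn.union {S₁ S₂ : Set ℝ}
    {u : ℝ → EuclideanSpace ℝ (Fin 3) → EuclideanSpace ℝ (Fin 3)}
    (h₁ : HasBoundedSobolevNormsOn S₁ u) (h₂ : HasBoundedSobolevNormsOn S₂ u) :
    HasBoundedSobolevNormsOn (S₁ ∪ S₂) u := fun n => by
  obtain ⟨C₁, hC₁⟩ := h₁ n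
  obtain ⟨C₂, hC₂⟩ := h₂ n
  exact ⟨max C₁ C₂, fun t ht => ht.elim
    (fun h => (hC₁ t h).trans (ENNReal.coe_le_coe.2 (le_max_left _ _)))
    (fun h => (hC₂ t h).trans (ENNReal.coe_le_coe.2 (le_max_right _ _)))⟩

/-- **Restart step for `H¹` data.** Let `(u, p)` be a finite energy classical solution on
`[0, T] × ℝ³`, `ν > 0`, and assume Tao's local `H¹` theory in the almost-regular form
`tao2011_H1_local_almost_regular` (Thm. 5.4 (i)–(ii) with Prop. 5.6; lifespan constant `c`). For
`A ≥ 0` put `τ = cν³/(A² + 1)`. If `0 ≤ s < T` and `‖u(s)‖²_{L²} + ‖∇u(s)‖²_{L²} ≤ A`, then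
`u ∈ L^∞_t H^k_x([s + τ₁, min(s + τ, T)] × ℝ³)` for all `k` and every `0 < τ₁ < min(τ, T − s)`:
the datum `u(s)` is in `H¹`, weakly divergence free, so the fact gives a Leray–Hopf solution `v`
on `[0, τ')`, `τ' = min(τ, T − s)`, from `u(s)`, `H¹`-continuous on `[0, τ']` — hence in the
Serrin class `L^∞_t L⁶_x` (`memLqLp_top_six_of_isH1RegularOn_Icc`) — and represented on
`[τ₁, τ']` by a classical solution `w` with all Sobolev norms bounded; the translate `u(· + s)` is
a Leray–Hopf solution from the same datum (`isLerayHopfOn_translate_of_finiteEnergy`, Lemma 8.1 +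
Lemma 4.1 (i)); by the Prodi–Serrin weak–strong uniqueness theorem
(`serrin_weak_strong_uniqueness_holds`) `u(t + s) = v(t) = w(t)` a.e., hence `u(t + s) = w(t)`
everywhere by continuity for `τ₁ ≤ t ≤ τ'`, and the Sobolev bounds of `w` transfer to `u`
(Robinson–Rodrigo–Sadowski 2016, proof of Lemma 6.11). [cite: Tao2011, Thm. 5.4 (i)-(ii) and Prop. 5.6; RobinsonRodrigoSadowski2016, Lemma 6.11 (proof)] -/
theorem hasBoundedSobolevNormsOn_Icc_restart_of_almostRegular
    (hAR : tao2011_H1_local_almost_regular) {ν T : ℝ} (hν : 0 < ν)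
    {u : ℝ → EuclideanSpace ℝ (Fin 3) → EuclideanSpace ℝ (Fin 3)}
    {p : ℝ → EuclideanSpace ℝ (Fin 3) → ℝ}
    (hsol : IsClassicalNSSolutionOn (Icc 0 T) ν 0 u p)
    (hfe : ∃ C : ℝ≥0∞, C < ⊤ ∧ ∀ t ∈ Icc 0 T, ∫⁻ x, ‖u t x‖ₑ ^ 2 ≤ C) {Ab : ℝ} (hAb : 0 ≤ Ab) :
    ∃ τ : ℝ, 0 < τ ∧ ∀ ⦃s : ℝ⦄, 0 ≤ s → s < T →
      (∫⁻ x, ‖u s x‖ₑ ^ 2) + (∫⁻ x, ENNReal.ofReal (frobeniusNormSq (fderiv ℝ (u s) x))) ≤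
          ENNReal.ofReal Ab →
      ∀ ⦃τ₁ : ℝ⦄, 0 < τ₁ → τ₁ < min τ (T - s) →
        HasBoundedSobolevNormsOn (Icc (s + τ₁) (min (s + τ) T)) u := by
  obtain ⟨c, hc, har⟩ := hAR
  set τ : ℝ := c * ν ^ 3 / (Ab ^ 2 + 1) with hτ
  have hτpos : 0 < τ := by positivity
  refine ⟨τ, hτpos, fun s hs0 hsT hH1 τ₁ hτ₁ hτ₁lt => ?_⟩
  -- the local lifespan actually used
  set τ' : ℝ := min τ (T - s) with hτ'
  have hτ'pos : 0 < τ' := lt_min hτpos (by linarith)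
  have hτ'τ : τ' ≤ τ := min_le_left _ _
  have hsτ'T : s + τ' ≤ T := by
    have := min_le_right τ (T - s)
    linarith
  have hmin : min (s + τ) T = s + τ' := by
    have h := min_add_add_left s τ (T - s)
    rwa [add_sub_cancel] at h
  have hsmallE : Ab ^ 2 * τ' ≤ c * ν ^ 3 :=
    calc Ab ^ 2 * τ' ≤ Ab ^ 2 * τ := by gcongr
      _ ≤ (Ab ^ 2 + 1) * τ := by gcongr; linarith
      _ = c * ν ^ 3 := by rw [hτ]; field_simp
  -- the datum `u(s)`
  have hsI : s ∈ Icc 0 T := ⟨hs0, hsT.le⟩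
  have hus : ContDiff ℝ ∞ (u s) := hsol.contDiff_velocity hsI
  have hus1 : ContDiff ℝ 1 (u s) := hus.of_le (by exact_mod_cast le_top)
  obtain ⟨Cfe, hCfe, hCfet⟩ := hfe
  have hu₀ : MemLp (u s) 2 volume :=
    memLp_two_of_lintegral_lt_top hus.continuous ((hCfet s hsI).trans_lt hCfe)
  -- the translate `u(· + s)` is a Leray–Hopf solution from `u(s)` on `[0, τ')`
  have hsτ'pos : 0 < s + τ' := by linarith
  have hsol'' : IsClassicalNSSolutionOn (Icc 0 (s + τ')) ν 0 u p :=
    hsol.mono (Icc_subset_Icc_right hsτ'T) (uniqueDiffOn_Icc hsτ'pos)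
  have hfe'' : ∃ A : ℝ≥0∞, A < ⊤ ∧ ∀ t ∈ Icc 0 (s + τ'), ∫⁻ x, ‖u t x‖ₑ ^ 2 ≤ A :=
    ⟨Cfe, hCfe, fun t ht => hCfet t (Icc_subset_Icc_right hsτ'T ht)⟩
  have hLHu : IsLerayHopfOn τ' ν 0 (u s) (fun t => u (t + s)) := by
    have h := (isLerayHopfOn_translate_of_finiteEnergy hsol'' hν hs0 (by linarith) hfe'').1
    rwa [add_sub_cancel_left] at h
  -- `u(s)` is an `H¹` datum, weakly divergence free
  have hdiv : IsWeaklyDivFree (u s) := hLHu.isWeaklyDivFree_datum hτ'pos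
  have hH1' : eH1NormSq (u s) ≤ ENNReal.ofReal Ab :=
    (eH1NormSq_le_of_hasWeakGradient (hasWeakGradient_fderiv_of_contDiff hus1)).trans hH1
  -- Thm. 5.4 (i)–(ii) + Prop. 5.6: the almost regular local solution `v` from `u(s)`
  obtain ⟨v, hLHv, hv0, hreg, hrep⟩ := har hν hτ'pos hu₀ hdiv hAb hH1' hsmallE
  -- weak–strong uniqueness in the Serrin class `L^∞_t L⁶_x`
  have hS : MemLqLp ∞ 6 v (Ioo 0 τ') :=
    memLqLp_top_six_of_isH1RegularOn_Icc hreg fun t ht => hLHv.memLp t ht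
  have hqr : 2 / (∞ : ℝ≥0∞) + 3 / 6 ≤ 1 := by
    rw [ENNReal.div_top, zero_add]
    exact ENNReal.div_le_of_le_mul (by norm_num)
  have hae : ∀ t ∈ Ioc 0 τ', (fun t => u (t + s)) t =ᵐ[volume] v t :=
    serrin_weak_strong_uniqueness_holds hν hτ'pos hLHv hu₀ (q := ∞) (r := 6) (by norm_num) hqr
      hS hLHu
  -- the classical representative of `v` on `[τ₁, τ']`
  have hτ₁τ' : τ₁ < τ' := hτ₁lt
  obtain ⟨w, π, hw, hHBw, -, -, hvw⟩ := hrep ⟨hτ₁, hτ₁τ'⟩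
  have heq : ∀ t ∈ Icc τ₁ τ', u (t + s) = w t := by
    intro t ht
    have ht0 : 0 < t := hτ₁.trans_le ht.1
    have h1 : u (t + s) =ᵐ[volume] v t := hae t ⟨ht0, ht.2⟩
    have h2 : v t =ᵐ[volume] w t := hvw t ht
    have htI : t + s ∈ Icc 0 T := ⟨by linarith, by linarith [ht.2]⟩
    exact (Continuous.ae_eq_iff_eq volume (hsol.contDiff_velocity htI).continuous
      (hw.contDiff_velocity ht).continuous).1 (h1.trans h2)
  -- transfer of the Sobolev bounds to `[s + τ₁, s + τ']`
  rw [hmin]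
  intro n
  obtain ⟨C₂, hC₂⟩ := hHBw n
  refine ⟨C₂, fun t ht => ?_⟩
  have h1 : t - s ∈ Icc τ₁ τ' := ⟨by linarith [ht.1], by linarith [ht.2]⟩
  have h2 : u t = w (t - s) := by
    have := heq (t - s) h1
    rwa [sub_add_cancel] at this
  rw [h2]
  exact hC₂ _ h1

/-! ## Step 3: the induction — strongness away from `t = 0` and the uniform `H¹` bound -/

/-- **Strongness away from `t = 0` and the uniform `H¹` bound, from the local `H¹` theory and the
a priori Thm. 10.1.** Let `(u, p)` be a finite energy classical solution of the unforced
Navier–Stokes system on the closed slab `[0, T] × ℝ³` (`ν > 0`) with `∇u(0) ∈ L²`. Assume Tao's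
local `H¹` theory in the almost-regular form (`tao2011_H1_local_almost_regular`, Thm. 5.4 (i)–(ii)
with Prop. 5.6) and the a priori form of Thm. 10.1
(`tao2011_enstrophyLocalisation_exterior_apriori`). Then `u ∈ L^∞_t H^k_x([ε, T] × ℝ³)` for all
`k` and every `0 < ε < T`, and `sup_{t ∈ [0,T]} ∫‖Du(t)‖² < ∞`. Proof (a restart induction, as
in `tao2011_hasBoundedSobolevNormsOn_of_localExistence_of_apriori` but for `H¹` rather than
Schwartz data): with the uniform gradient bound `H` of `exists_uniform_gradient_bound_of_forall`
and `A = sup_t ∫|u|² + 3H + ∫|∇u(0)|²_F`, every `s ∈ [0, T)` up to which `u` is strong away from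
zero restarts with `‖u(s')‖²_{H¹} ≤ A` at `s' = max(s − τ/2, 0)`
(`hasBoundedSobolevNormsOn_Icc_restart_of_almostRegular`, lifespan `τ = cν³/(A² + 1)`), the new
strong segment `[s' + τ₁, min(s' + τ, T)]` overlapping the old ones; so strongness away from zero
propagates from `[0, 0]` to `[0, min(kτ/2, T)]` for every `k`. Closedness of the slab is
essential (Tao 2011, Remark 11.2). [cite: Tao2011, Cor. 11.1 + Thm. 5.4 (i)-(ii) and Prop. 5.6 + Thm. 10.1] -/
theorem forall_hasBoundedSobolevNormsOn_Icc_of_almostRegular_of_apriori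
    (hAR : tao2011_H1_local_almost_regular)
    (hA : tao2011_enstrophyLocalisation_exterior_apriori)
    {ν T : ℝ} (hν : 0 < ν) (hT : 0 < T)
    {u : ℝ → EuclideanSpace ℝ (Fin 3) → EuclideanSpace ℝ (Fin 3)}
    {p : ℝ → EuclideanSpace ℝ (Fin 3) → ℝ}
    (hsol : IsClassicalNSSolutionOn (Icc 0 T) ν 0 u p)
    (hfe : ∃ C : ℝ≥0∞, C < ⊤ ∧ ∀ t ∈ Icc 0 T, ∫⁻ x, ‖u t x‖ₑ ^ 2 ≤ C)
    (h₁ : ∫⁻ x, ‖iteratedFDeriv ℝ 1 (u 0) x‖ₑ ^ 2 < ⊤) :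
    (∀ ε ∈ Ioo 0 T, HasBoundedSobolevNormsOn (Icc ε T) u) ∧
      ∃ H : ℝ≥0∞, H < ⊤ ∧ ∀ t ∈ Icc 0 T, ∫⁻ x, ‖iteratedFDeriv ℝ 1 (u t) x‖ₑ ^ 2 ≤ H := by
  obtain ⟨C, hC, hCt⟩ := hfe
  -- Step 1: the uniform gradient bound on initial segments strong away from zero
  obtain ⟨H, hHtop, hH⟩ := exists_uniform_gradient_bound_of_forall hA hν hT hsol ⟨C, hC, hCt⟩ h₁
  -- the `H¹` budget `Ab` at restart times
  set D₀ : ℝ≥0∞ := ∫⁻ x, ENNReal.ofReal (frobeniusNormSq (fderiv ℝ (u 0) x)) with hD₀def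
  have hD₀ : D₀ < ⊤ :=
    (lintegral_frobeniusNormSq_le_three_mul_iteratedFDeriv_one (u 0)).trans_lt
      (ENNReal.mul_lt_top (by simp) h₁)
  have h3H : 3 * H ≠ ⊤ := ENNReal.mul_ne_top (by simp) hHtop.ne
  set Ab : ℝ := C.toReal + (3 * H).toReal + D₀.toReal with hAbdef
  have hAb : 0 ≤ Ab := by positivity
  -- the property propagated by the induction: strong on `[ε, s]` for every `0 < ε < s`
  set Q : ℝ → Prop := fun s => ∀ ε ∈ Ioo 0 s, HasBoundedSobolevNormsOn (Icc ε s) u with hQdef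
  have hbound : ∀ ⦃s : ℝ⦄, 0 ≤ s → s ≤ T → Q s → ∀ s' ∈ Icc 0 s,
      (∫⁻ x, ‖u s' x‖ₑ ^ 2) + (∫⁻ x, ENNReal.ofReal (frobeniusNormSq (fderiv ℝ (u s') x))) ≤
        ENNReal.ofReal Ab := by
    intro s hs0 hsT hQ s' hs'
    have hL2 : ∫⁻ x, ‖u s' x‖ₑ ^ 2 ≤ C := hCt s' ⟨hs'.1, hs'.2.trans hsT⟩
    have hgrad : ∫⁻ x, ENNReal.ofReal (frobeniusNormSq (fderiv ℝ (u s') x)) ≤ 3 * H + D₀ := by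
      rcases eq_or_lt_of_le hs'.1 with h0 | hs'0
      · rw [← h0]
        exact le_add_self
      · refine le_trans ?_ le_self_add
        have hspos : 0 < s := hs'0.trans_le hs'.2
        exact (lintegral_frobeniusNormSq_le_three_mul_iteratedFDeriv_one (u s')).trans
          (mul_le_mul_right (hH hspos hsT hQ s' hs') 3)
    calc (∫⁻ x, ‖u s' x‖ₑ ^ 2) + (∫⁻ x, ENNReal.ofReal (frobeniusNormSq (fderiv ℝ (u s') x)))
        ≤ C + (3 * H + D₀) := add_le_add hL2 hgrad
      _ = ENNReal.ofReal Ab := by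
          rw [hAbdef, ENNReal.ofReal_add (by positivity) ENNReal.toReal_nonneg,
            ENNReal.ofReal_add (by positivity) ENNReal.toReal_nonneg,
            ENNReal.ofReal_toReal hC.ne, ENNReal.ofReal_toReal h3H, ENNReal.ofReal_toReal hD₀.ne,
            add_assoc]
  -- Step 2: the restart with uniform step `τ`
  obtain ⟨τ, hτ, hstep⟩ :=
    hasBoundedSobolevNormsOn_Icc_restart_of_almostRegular hAR hν hsol ⟨C, hC, hCt⟩ hAb
  -- the key propagation `Q(s) → Q(min(s + τ/2, T))`
  have hkey : ∀ ⦃s : ℝ⦄, 0 ≤ s → s < T → Q s → Q (min (s + τ / 2) T) := by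
    intro s hs0 hsT hQ ε hε
    set s' : ℝ := max (s - τ / 2) 0 with hs'def
    have hs'0 : 0 ≤ s' := le_max_right _ _
    have hs's : s' ≤ s := max_le (by linarith) hs0
    have hs'T : s' < T := hs's.trans_lt hsT
    have hss' : s - τ / 2 ≤ s' := le_max_left _ _
    have hR := hstep hs'0 hs'T (hbound hs0 hsT.le hQ s' ⟨hs'0, hs's⟩)
    have hSle : min (s + τ / 2) T ≤ min (s' + τ) T := min_le_min_right T (by linarith)
    have hεS : ε < min (s + τ / 2) T := hε.2
    have hεT : ε < T := hεS.trans_le (min_le_right _ _)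
    have hεs : ε < s + τ / 2 := hεS.trans_le (min_le_left _ _)
    by_cases hεs' : s' < ε
    · -- one new strong segment suffices
      have h1 : 0 < ε - s' := by linarith
      have h2 : ε - s' < min τ (T - s') := lt_min (by linarith) (by linarith)
      have h := hR h1 h2
      rw [add_sub_cancel] at h
      exact h.mono (Icc_subset_Icc_right hSle)
    · -- glue an old segment `[ε, s]` with the new one `[s' + τ/4, min(s' + τ, T)]`
      push Not at hεs'
      have hs'pos : 0 < s' := hε.1.trans_le hεs'
      have hs'eq : s' = s - τ / 2 := by
        rcases le_or_gt (s - τ / 2) 0 with h | h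
        · exfalso
          rw [hs'def, max_eq_right h] at hs'pos
          exact lt_irrefl _ hs'pos
        · exact max_eq_left h.le
      have hεlt : ε < s := by linarith
      have hP1 : HasBoundedSobolevNormsOn (Icc ε s) u := hQ ε ⟨hε.1, hεlt⟩
      have h1 : (0 : ℝ) < τ / 4 := by positivity
      have h2 : τ / 4 < min τ (T - s') := lt_min (by linarith) (by linarith)
      have hP2 := hR h1 h2
      have hcov : Icc ε (min (s + τ / 2) T) ⊆ Icc ε s ∪ Icc (s' + τ / 4) (min (s' + τ) T) := by
        intro t ht
        rcases le_or_gt t s with hts | hts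
        · exact Or.inl ⟨ht.1, hts⟩
        · exact Or.inr ⟨by rw [hs'eq]; linarith, ht.2.trans hSle⟩
      exact (hP1.union hP2).mono hcov
  -- Step 3: induction on the number of restarts
  have hind : ∀ k : ℕ, Q (min ((k : ℝ) * (τ / 2)) T) := by
    intro k
    induction k with
    | zero =>
      intro ε hε
      rw [Nat.cast_zero, zero_mul, min_eq_left hT.le] at hε
      exact absurd hε.2 (not_lt.2 hε.1.le)
    | succ k ih =>
      by_cases hkT : (k : ℝ) * (τ / 2) < T
      · rw [min_eq_left hkT.le] at ih
        have hk0 : 0 ≤ (k : ℝ) * (τ / 2) := by positivity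
        have h := hkey hk0 hkT ih
        have e : (k : ℝ) * (τ / 2) + τ / 2 = ((k + 1 : ℕ) : ℝ) * (τ / 2) := by push_cast; ring
        rwa [e] at h
      · have hkT' : T ≤ (k : ℝ) * (τ / 2) := not_lt.1 hkT
        rw [min_eq_right hkT'] at ih
        have hk1 : T ≤ ((k + 1 : ℕ) : ℝ) * (τ / 2) := by
          push_cast
          nlinarith
        rwa [min_eq_right hk1]
  obtain ⟨k, hk⟩ : ∃ k : ℕ, T ≤ (k : ℝ) * (τ / 2) := by
    obtain ⟨k, hk⟩ := exists_nat_ge (T / (τ / 2))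
    exact ⟨k, by rwa [div_le_iff₀ (by positivity)] at hk⟩
  have hQT : Q T := by
    have h := hind k
    rwa [min_eq_right hk] at h
  exact ⟨hQT, H, hHtop, hH hT le_rfl hQT⟩

/-! ## Step 4: `∇²u ∈ L²_{t,x}` by the Foias–Guillopé–Temam dissipation bound, and `u ∈ X¹` -/

/-- **`L²_t H²_x` from strongness away from zero and a uniform `H¹` bound.** Let `(u, p)` be a
finite energy classical solution on `[0, T] × ℝ³` (`ν > 0`) which is strong on `[ε, T]` for every
`ε > 0` and satisfies `∫‖Du(t)‖² ≤ H < ∞` on `[0, T]`. Then `∫₀ᵀ∫‖D²u‖² < ∞`. Proof: on each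
`[ε, T]` the proved Foias–Guillopé–Temam normalised-enstrophy estimate
(`StrongData.fgt_dissipation`, Robinson–Rodrigo–Sadowski 2016, Lemma 8.15:
`ν∫ z/(1 + y)² ≤ 1 + C_Y ν⁻³ ∫ y`, `y = ∫|Ω|²`, `z = ∫|∇Ω|²`) together with `y ≤ 36 H` and
`∫ y ≤ 4E/ν` (Lemma 8.1) bounds `∫_ε^T z` independently of `ε`; the global div–curl bound
`∫|∇²u|² ≤ ∫|∇Ω|²` and `‖D²u‖² ≤ 27|∇²u|²` convert this into a bound for `∫_ε^T∫‖D²u‖²`, and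
`ε → 0` is monotone convergence. [cite: RobinsonRodrigoSadowski2016, Lemma 8.15; Tao2011, Lemma 8.1] -/
theorem lintegral_Ioo_iteratedFDeriv_two_lt_top_of_forall {ν T : ℝ} (hν : 0 < ν) (hT : 0 < T)
    {u : ℝ → EuclideanSpace ℝ (Fin 3) → EuclideanSpace ℝ (Fin 3)}
    {p : ℝ → EuclideanSpace ℝ (Fin 3) → ℝ}
    (hsol : IsClassicalNSSolutionOn (Icc 0 T) ν 0 u p)
    (hfe : ∃ C : ℝ≥0∞, C < ⊤ ∧ ∀ t ∈ Icc 0 T, ∫⁻ x, ‖u t x‖ₑ ^ 2 ≤ C)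
    (hHB : ∀ ε ∈ Ioo 0 T, HasBoundedSobolevNormsOn (Icc ε T) u)
    {H : ℝ≥0∞} (hHtop : H < ⊤) (hH : ∀ t ∈ Icc 0 T, ∫⁻ x, ‖iteratedFDeriv ℝ 1 (u t) x‖ₑ ^ 2 ≤ H) :
    (∫⁻ t in Ioo 0 T, ∫⁻ x, ‖iteratedFDeriv ℝ 2 (u t) x‖ₑ ^ 2) < ⊤ := by
  have hu : ∀ t ∈ Icc 0 T, ContDiff ℝ ∞ (u t) := fun t ht => hsol.contDiff_velocity ht
  -- the energy class (Lemma 8.1)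
  obtain ⟨A₀, hA₀, -, hD, -⟩ := energyClass_of_finiteEnergy hsol hν hT hfe
  set E : ℝ := A₀.toReal with hEdef
  have hE : 0 ≤ E := ENNReal.toReal_nonneg
  have hD' : ENNReal.ofReal ν *
      ∫⁻ t in Ioo 0 T, ∫⁻ x, ENNReal.ofReal (frobeniusNormSq (fderiv ℝ (u t) x)) ≤
        ENNReal.ofReal E := by rwa [hEdef, ENNReal.ofReal_toReal hA₀]
  -- the uniform enstrophy bound `y ≤ Y`
  set Y : ℝ := 4 * (3 ^ (1 + 1) * H.toReal) with hYdef
  have hY0 : 0 ≤ Y := by positivity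
  have hlev1 : ∀ t ∈ Icc 0 T, Integrable (levelSq 1 (u t)) ∧
      ∫ x, levelSq 1 (u t) x ≤ 3 ^ (1 + 1) * H.toReal := by
    intro t ht
    obtain ⟨hi, hle⟩ := integrable_levelSq_of_lintegral_lt_top (hu t ht) 1
      ((hH t ht).trans_lt hHtop)
    exact ⟨hi, hle.trans (mul_le_mul_of_nonneg_left (ENNReal.toReal_mono hHtop.ne (hH t ht))
      (by positivity))⟩
  have hens : ∀ t ∈ Icc 0 T, enstrophyAt u t ≤ Y := by
    intro t ht
    have hv := hu t ht
    obtain ⟨hi, hle⟩ := hlev1 t ht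
    have hB : Integrable (vortSq 0 (u t)) :=
      (hi.const_mul 4).mono' (continuous_vortSq hv 0).aestronglyMeasurable
        (Eventually.of_forall fun x => by
          rw [Real.norm_of_nonneg (vortSq_nonneg 0 _ x)]
          exact vortSq_le_four_mul_levelSq_succ hv 0 x)
    calc enstrophyAt u t = ∫ x, vortSq 0 (u t) x := rfl
      _ ≤ ∫ x, 4 * levelSq 1 (u t) x :=
          integral_mono hB (hi.const_mul 4) fun x => vortSq_le_four_mul_levelSq_succ hv 0 x
      _ = 4 * ∫ x, levelSq 1 (u t) x := integral_const_mul _ _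
      _ ≤ Y := by rw [hYdef]; gcongr
  -- the bound on each `[ε, T]`
  set B : ℝ := (1 + Y) ^ 2 * (ν⁻¹ * (1⁻¹ + youngConst * ν⁻¹ ^ 3 * (4 * E / ν))) with hBdef
  have htr : ∀ (ε : ℝ) (g : ℝ → ℝ≥0∞), ∫⁻ t in Ioo 0 (T - ε), g (t + ε) = ∫⁻ t in Ioo ε T, g t :=
    fun ε g => by rw [setLIntegral_Ioo_comp_add_right g 0 (T - ε) ε, zero_add, sub_add_cancel]
  have hstep : ∀ ε ∈ Ioo 0 T, ∫⁻ t in Ioo ε T, ∫⁻ x, ‖iteratedFDeriv ℝ 2 (u t) x‖ₑ ^ 2 ≤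
      ENNReal.ofReal (27 * B) := by
    intro ε hε
    have hTε : 0 < T - ε := by linarith [hε.2]
    -- the translate, a strong solution on `[0, T - ε]`
    have hsol' : IsClassicalNSSolutionOn (Icc 0 (T - ε)) ν 0 (fun t => u (t + ε))
        (fun t => p (t + ε)) :=
      (hsol.comp_add_right ε).mono (fun t ht => ⟨by linarith [ht.1, hε.1], by linarith [ht.2]⟩)
        (uniqueDiffOn_Icc hTε)
    have hmaps : ∀ t ∈ Icc 0 (T - ε), t + ε ∈ Icc 0 T := fun t ht =>
      ⟨by linarith [ht.1, hε.1], by linarith [ht.2]⟩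
    have hHB' : HasBoundedSobolevNormsOn (Icc 0 (T - ε)) (fun t => u (t + ε)) := fun n => by
      obtain ⟨C, hC⟩ := hHB ε hε n
      exact ⟨C, fun t ht => hC (t + ε) ⟨by linarith [ht.1], by linarith [ht.2]⟩⟩
    obtain ⟨d⟩ := hsol'.nonempty_strongData hTε hHB'
    have hD'' : ENNReal.ofReal ν *
        ∫⁻ t in Ioo 0 (T - ε), ∫⁻ x,
          ENNReal.ofReal (frobeniusNormSq (fderiv ℝ (u (t + ε)) x)) ≤ ENNReal.ofReal E := by
      rw [htr ε (fun t => ∫⁻ x, ENNReal.ofReal (frobeniusNormSq (fderiv ℝ (u t) x)))]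
      exact (mul_le_mul_right (lintegral_mono_set (Ioo_subset_Ioo_left hε.1.le)) _).trans hD'
    -- FGT with `α = 1`, and `∫ y ≤ 4E/ν`
    have hfgt := d.fgt_dissipation hsol' hν hTε one_pos
    have hyint := d.integral_enstrophyAt_le hsol' hν hTε hE hD''
    have hq_le : ∫ τ in Ioo 0 (T - ε), palinstrophyAt (fun t => u (t + ε)) τ /
        (1 + enstrophyAt (fun t => u (t + ε)) τ) ^ 2 ≤
          ν⁻¹ * (1⁻¹ + youngConst * ν⁻¹ ^ 3 * (4 * E / ν)) := by
      have hyc : 0 ≤ youngConst * ν⁻¹ ^ 3 := by have := youngConst_nonneg; positivity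
      have h2 : ν * ∫ τ in Ioo 0 (T - ε), palinstrophyAt (fun t => u (t + ε)) τ /
          (1 + enstrophyAt (fun t => u (t + ε)) τ) ^ 2 ≤
            1⁻¹ + youngConst * ν⁻¹ ^ 3 * (4 * E / ν) :=
        hfgt.trans (by nlinarith [mul_le_mul_of_nonneg_left hyint hyc])
      calc ∫ τ in Ioo 0 (T - ε), palinstrophyAt (fun t => u (t + ε)) τ /
            (1 + enstrophyAt (fun t => u (t + ε)) τ) ^ 2
          = ν⁻¹ * (ν * ∫ τ in Ioo 0 (T - ε), palinstrophyAt (fun t => u (t + ε)) τ /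
              (1 + enstrophyAt (fun t => u (t + ε)) τ) ^ 2) := by
            rw [← mul_assoc, inv_mul_cancel₀ hν.ne', one_mul]
        _ ≤ ν⁻¹ * (1⁻¹ + youngConst * ν⁻¹ ^ 3 * (4 * E / ν)) :=
            mul_le_mul_of_nonneg_left h2 (inv_nonneg.2 hν.le)
    -- integrability of `z` and of `z/(1+y)²` on `(0, T - ε)`
    have hzm := d.aestronglyMeasurable_palinstrophyAt hsol' hTε
    have hym := d.aestronglyMeasurable_enstrophyAt hsol' hTε
    have hz0 : ∀ t, 0 ≤ palinstrophyAt (fun t => u (t + ε)) t := palinstrophyAt_nonneg _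
    have hy0 : ∀ t, 0 ≤ enstrophyAt (fun t => u (t + ε)) t := enstrophyAt_nonneg _
    have hzint : IntegrableOn (palinstrophyAt (fun t => u (t + ε))) (Ioo 0 (T - ε)) :=
      integrableOn_Ioo_of_bound hzm (M := 4 * d.S 2) fun t ht => by
        rw [abs_of_nonneg (hz0 t)]
        exact d.palinstrophyAt_le hsol' ht
    have hqint : IntegrableOn (fun τ => palinstrophyAt (fun t => u (t + ε)) τ /
        (1 + enstrophyAt (fun t => u (t + ε)) τ) ^ 2) (Ioo 0 (T - ε)) := by
      refine integrableOn_Ioo_of_bound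
        ((hzm.aemeasurable.div
          ((aemeasurable_const.add hym.aemeasurable).pow_const 2)).aestronglyMeasurable)
        (M := 4 * d.S 2) fun t ht => ?_
      have hpos : 0 < 1 + enstrophyAt (fun t => u (t + ε)) t := by linarith [hy0 t]
      rw [abs_div, abs_of_nonneg (hz0 t), abs_of_pos (pow_pos hpos 2)]
      refine (div_le_self (hz0 t) ?_).trans (d.palinstrophyAt_le hsol' ht)
      nlinarith [hy0 t]
    -- `∫ z ≤ (1+Y)² ∫ z/(1+y)² ≤ B`
    have hz_le : ∫ τ in Ioo 0 (T - ε), palinstrophyAt (fun t => u (t + ε)) τ ≤ B := by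
      calc ∫ τ in Ioo 0 (T - ε), palinstrophyAt (fun t => u (t + ε)) τ
          ≤ ∫ τ in Ioo 0 (T - ε), (1 + Y) ^ 2 * (palinstrophyAt (fun t => u (t + ε)) τ /
              (1 + enstrophyAt (fun t => u (t + ε)) τ) ^ 2) := by
            refine setIntegral_mono_on hzint (hqint.const_mul _) measurableSet_Ioo fun τ hτ => ?_
            have hpos : 0 < 1 + enstrophyAt (fun t => u (t + ε)) τ := by linarith [hy0 τ]
            have hyτ : enstrophyAt (fun t => u (t + ε)) τ ≤ Y :=
              hens (τ + ε) (hmaps τ (Ioo_subset_Icc_self hτ))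
            have hle : (1 + enstrophyAt (fun t => u (t + ε)) τ) ^ 2 ≤ (1 + Y) ^ 2 :=
              pow_le_pow_left₀ hpos.le (by linarith) 2
            calc palinstrophyAt (fun t => u (t + ε)) τ
                = (1 + enstrophyAt (fun t => u (t + ε)) τ) ^ 2 *
                    (palinstrophyAt (fun t => u (t + ε)) τ /
                      (1 + enstrophyAt (fun t => u (t + ε)) τ) ^ 2) := by
                  rw [mul_div_cancel₀ _ (pow_pos hpos 2).ne']
              _ ≤ (1 + Y) ^ 2 * (palinstrophyAt (fun t => u (t + ε)) τ /
                      (1 + enstrophyAt (fun t => u (t + ε)) τ) ^ 2) :=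
                  mul_le_mul_of_nonneg_right hle (div_nonneg (hz0 τ) (sq_nonneg _))
        _ = (1 + Y) ^ 2 * ∫ τ in Ioo 0 (T - ε), palinstrophyAt (fun t => u (t + ε)) τ /
              (1 + enstrophyAt (fun t => u (t + ε)) τ) ^ 2 := integral_const_mul _ _
        _ ≤ B := by rw [hBdef]; exact mul_le_mul_of_nonneg_left hq_le (sq_nonneg _)
    -- pointwise in `t ∈ (ε, T)`: `∫⁻ ‖D²u(t)‖ₑ² ≤ ofReal (27 z(t - ε))`
    have hpt : ∀ t ∈ Ioo ε T, ∫⁻ x, ‖iteratedFDeriv ℝ 2 (u t) x‖ₑ ^ 2 ≤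
        ENNReal.ofReal (27 * palinstrophyAt (fun t => u (t + ε)) (t - ε)) := by
      intro t ht
      have htI : t - ε ∈ Icc 0 (T - ε) := ⟨by linarith [ht.1], by linarith [ht.2]⟩
      have htT : t ∈ Icc 0 T := ⟨by linarith [ht.1, hε.1], ht.2.le⟩
      have hv : ContDiff ℝ ∞ (u t) := hu t htT
      have hi1 : Integrable (levelSq 1 (u t)) := by
        have := d.integrable_levelSq 1 (t - ε) htI
        simpa only [sub_add_cancel] using this
      have hi2 : Integrable (levelSq 2 (u t)) := by
        have := d.integrable_levelSq 2 (t - ε) htI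
        simpa only [sub_add_cancel] using this
      have hdc := integral_levelSq_succ_le_integral_vortSq hv
        (hsol.sum_pderiv_comp_eq_zero htT) 1 hi1 hi2
      have hpal : ∫ x, vortSq 1 (u t) x = palinstrophyAt (fun t => u (t + ε)) (t - ε) := by
        simp only [palinstrophyAt, sub_add_cancel]
      refine (lintegral_sq_norm_iteratedFDeriv_le hv 2 hi2).trans (ENNReal.ofReal_le_ofReal ?_)
      rw [← hpal]
      norm_num
      linarith
    -- integrate over `(ε, T)` and change variables
    have hint27 : IntegrableOn (fun τ => 27 * palinstrophyAt (fun t => u (t + ε)) τ)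
        (Ioo 0 (T - ε)) := hzint.const_mul 27
    calc ∫⁻ t in Ioo ε T, ∫⁻ x, ‖iteratedFDeriv ℝ 2 (u t) x‖ₑ ^ 2
        ≤ ∫⁻ t in Ioo ε T, ENNReal.ofReal (27 * palinstrophyAt (fun t => u (t + ε)) (t - ε)) :=
          setLIntegral_mono' measurableSet_Ioo hpt
      _ = ∫⁻ τ in Ioo 0 (T - ε), ENNReal.ofReal (27 * palinstrophyAt (fun t => u (t + ε)) τ) := by
          rw [← htr ε (fun t => ENNReal.ofReal (27 * palinstrophyAt (fun t => u (t + ε)) (t - ε)))]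
          simp only [add_sub_cancel_right]
      _ = ENNReal.ofReal (∫ τ in Ioo 0 (T - ε), 27 * palinstrophyAt (fun t => u (t + ε)) τ) :=
          (ofReal_integral_eq_lintegral_ofReal hint27
            (ae_of_all _ fun τ => mul_nonneg (by norm_num) (hz0 τ))).symm
      _ ≤ ENNReal.ofReal (27 * B) := by
          rw [integral_const_mul]
          exact ENNReal.ofReal_le_ofReal (mul_le_mul_of_nonneg_left hz_le (by norm_num))
  -- exhaustion `ε → 0`
  rw [← iUnion_Ioo_div_nat_add_two hT, setLIntegral_iUnion_of_directed _
    (directed_Ioo_div_nat_add_two hT)]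
  exact (iSup_le fun n => hstep _ ⟨by positivity, div_lt_self hT (by linarith)⟩).trans_lt
    ENNReal.ofReal_lt_top

/-! ## Cor. 11.1 (`u ∈ X¹`) from the local `H¹` theory and the a priori Thm. 10.1 -/

/-- **`u ∈ X¹([0, T] × ℝ³)` from the local `H¹` theory and the a priori Thm. 10.1**: for a finite
energy classical solution on the closed slab with `∇u(0) ∈ L²`, the conclusion of Cor. 11.1
(`MemSobolevX 1 T u`) follows from `tao2011_H1_local_almost_regular` and
`tao2011_enstrophyLocalisation_exterior_apriori`
(`forall_hasBoundedSobolevNormsOn_Icc_of_almostRegular_of_apriori` for the `L^∞_t H¹_x` half and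
strongness away from zero, `lintegral_Ioo_iteratedFDeriv_two_lt_top_of_forall` for the
`L²_t H²_x` half). [cite: Tao2011, Cor. 11.1 + Thm. 5.4 (i)-(ii) and Prop. 5.6 + Thm. 10.1] -/
theorem memSobolevX_of_almostRegular_of_apriori
    (hAR : tao2011_H1_local_almost_regular)
    (hA : tao2011_enstrophyLocalisation_exterior_apriori)
    {ν T : ℝ} (hν : 0 < ν) (hT : 0 < T)
    {u : ℝ → EuclideanSpace ℝ (Fin 3) → EuclideanSpace ℝ (Fin 3)}
    {p : ℝ → EuclideanSpace ℝ (Fin 3) → ℝ}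
    (hsol : IsClassicalNSSolutionOn (Icc 0 T) ν 0 u p)
    (hfe : ∃ C : ℝ≥0∞, C < ⊤ ∧ ∀ t ∈ Icc 0 T, ∫⁻ x, ‖u t x‖ₑ ^ 2 ≤ C)
    (h₁ : ∫⁻ x, ‖iteratedFDeriv ℝ 1 (u 0) x‖ₑ ^ 2 < ⊤) :
    MemSobolevX 1 T u := by
  obtain ⟨hHB, H, hHtop, hH⟩ :=
    forall_hasBoundedSobolevNormsOn_Icc_of_almostRegular_of_apriori hAR hA hν hT hsol hfe h₁
  refine ⟨fun j hj => ?_,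
    lintegral_Ioo_iteratedFDeriv_two_lt_top_of_forall hν hT hsol hfe hHB hHtop hH⟩
  interval_cases j
  · obtain ⟨C, hC, hCt⟩ := hfe
    refine ⟨C.toNNReal, fun t ht => ?_⟩
    have e : ∀ x, ‖iteratedFDeriv ℝ 0 (u t) x‖ₑ = ‖u t x‖ₑ := fun x => by
      rw [← ofReal_norm, ← ofReal_norm, norm_iteratedFDeriv_zero]
    simp only [e]
    exact (hCt t ht).trans (ENNReal.coe_toNNReal hC.ne).ge
  · exact ⟨H.toNNReal, fun t ht => (hH t ht).trans (ENNReal.coe_toNNReal hHtop.ne).ge⟩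

/-- **Tao 2011, Cor. 11.1 (bounded enstrophy, every `ν > 0`) from Thm. 5.4 (i)–(ii) + Prop. 5.6
and the a priori Thm. 10.1** — the printed input Prop. 9.1 (bounded total speed for the general
finite energy almost smooth class, whose Littlewood–Paley proof is the leaf
`tao2011_duhamelNonlinearSpeed_unit` of the printed route) is replaced by its proved strong-class
form inside a restart induction driven by the local `H¹` theory (`tao2011_H1_local_almost_regular`,
itself the smoothing leaf of the Ladyzhenskaya–Prodi–Serrin programme). Compare
`tao2011_hasBoundedSobolevNormsOn_of_localExistence_of_apriori` (`TaoLocalisationContinuation`),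
the same device for Schwartz data. [cite: Tao2011, Cor. 11.1 + Thm. 5.4 (i)-(ii) and Prop. 5.6 + Thm. 10.1] -/
theorem tao2011_boundedEnstrophy_of_almostRegular_of_apriori
    (hAR : tao2011_H1_local_almost_regular)
    (hA : tao2011_enstrophyLocalisation_exterior_apriori) : tao2011_boundedEnstrophy := by
  intro ν T hν hT u p hsol hE h₀
  obtain ⟨C, hC⟩ := hE
  exact memSobolevX_of_almostRegular_of_apriori hAR hA hν hT hsol ⟨C, ENNReal.coe_lt_top, hC⟩ h₀

/-- **Cor. 11.1 at unit viscosity (as printed) from Thm. 5.4 (i)–(ii) + Prop. 5.6 and the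
unit-viscosity a priori Thm. 10.1** (the `ν = 1 ⇔ ν > 0` passages are the proved rescalings of
`TaoUnitViscosity`). [cite: Tao2011, Cor. 11.1 + Thm. 5.4 (i)-(ii) and Prop. 5.6 + Thm. 10.1] -/
theorem tao2011_boundedEnstrophy_unit_of_almostRegular_of_apriori_unit
    (hAR : tao2011_H1_local_almost_regular)
    (hA : tao2011_enstrophyLocalisation_exterior_apriori_unit) : tao2011_boundedEnstrophy_unit :=
  tao2011_boundedEnstrophy_iff_unit.1 (tao2011_boundedEnstrophy_of_almostRegular_of_apriori hAR
    (tao2011_enstrophyLocalisation_exterior_apriori_of_unit hA))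

/-- **Cor. 11.1 at unit viscosity from Thm. 5.4 (i)–(ii) + Prop. 5.6 and the annular a priori
Thm. 10.1 (Remark 10.6)** (passage annulus → exterior by monotone convergence,
`TaoEnstrophyLocalisationAnnulus`). [cite: Tao2011, Cor. 11.1 + Thm. 5.4 (i)-(ii) and Prop. 5.6 + Thm. 10.1 (Remark 10.6)] -/
theorem tao2011_boundedEnstrophy_unit_of_almostRegular_of_annulus
    (hAR : tao2011_H1_local_almost_regular)
    (hAnn : tao2011_enstrophyLocalisation_annulus_apriori_unit) : tao2011_boundedEnstrophy_unit :=
  tao2011_boundedEnstrophy_unit_of_almostRegular_of_apriori_unit hAR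
    (tao2011_enstrophyLocalisation_exterior_apriori_unit_of_annulus hAnn)

/-- **The sharpest leaf set of this route: Cor. 11.1 at unit viscosity from Thm. 5.4 (i)–(ii) +
Prop. 5.6 (`tao2011_H1_local_almost_regular`) and the nonlinear estimate `Y₆` of §10
(`tao2011_nonlinearEstimate`)**, the annular a priori Thm. 10.1 being assembled from the latter
in `TaoAnnulusAssembly`. On the printed route the second leaf is instead paired with
`tao2011_duhamelNonlinearSpeed_unit` (§9): `tao2011_boundedEnstrophy_of_nonlinearEstimate_of_duhamel`. [cite: Tao2011, Cor. 11.1 + Thm. 5.4 (i)-(ii) and Prop. 5.6 + Thm. 10.1 (proof, §10)] -/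
theorem tao2011_boundedEnstrophy_unit_of_almostRegular_of_nonlinearEstimate
    (hAR : tao2011_H1_local_almost_regular) (hY : tao2011_nonlinearEstimate) :
    tao2011_boundedEnstrophy_unit :=
  tao2011_boundedEnstrophy_unit_of_almostRegular_of_annulus hAR
    (tao2011_enstrophyLocalisation_annulus_apriori_unit_of_nonlinearEstimate hY)

/-- The `ν > 0` form of the previous statement. [cite: Tao2011, Cor. 11.1 + Thm. 5.4 (i)-(ii) and Prop. 5.6 + Thm. 10.1 (proof, §10)] -/
theorem tao2011_boundedEnstrophy_of_almostRegular_of_nonlinearEstimate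
    (hAR : tao2011_H1_local_almost_regular) (hY : tao2011_nonlinearEstimate) :
    tao2011_boundedEnstrophy :=
  tao2011_boundedEnstrophy_of_unit
    (tao2011_boundedEnstrophy_unit_of_almostRegular_of_nonlinearEstimate hAR hY)

/-- **Consequences down the chain**: with Cor. 11.1 obtained this way, the composite
`tao2011_hasBoundedSobolevNormsOn` (Cor. 11.1 + Cor. 4.3 + Thm. 5.4 (iv); the second half is the
tree theorem `tao2011_hasBoundedSobolevNormsOn_of_memSobolevX_holds`) follows from the same two
leaves. [cite: Tao2011, Cor. 11.1 + Cor. 4.3 + Thm. 5.4] -/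
theorem tao2011_hasBoundedSobolevNormsOn_of_almostRegular_of_nonlinearEstimate
    (hAR : tao2011_H1_local_almost_regular) (hY : tao2011_nonlinearEstimate) :
    tao2011_hasBoundedSobolevNormsOn :=
  tao2011_hasBoundedSobolevNormsOn_of_boundedEnstrophy
    (tao2011_boundedEnstrophy_of_almostRegular_of_nonlinearEstimate hAR hY)

/-- **Cor. 11.4 (unconditional uniqueness) as printed, its velocity form, and the duplicate
vendoring `tao_finite_energy_velocity_uniqueness`, from the same two leaves** (the `B`-side of
Remark 11.3, Cor. 4.3 + Thm. 5.4 (iii), is the tree theorem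
`tao2011_velocity_eq_of_memSobolevX_holds`). [cite: Tao2011, Cor. 11.4 (Remark 11.3)] -/
theorem tao_unconditional_uniqueness_of_almostRegular_of_nonlinearEstimate
    (hAR : tao2011_H1_local_almost_regular) (hY : tao2011_nonlinearEstimate) :
    tao_unconditional_uniqueness ∧ tao_unconditional_uniqueness_velocity ∧
      tao_finite_energy_velocity_uniqueness :=
  have hB := tao2011_boundedEnstrophy_of_almostRegular_of_nonlinearEstimate hAR hY
  ⟨(tao_unconditional_uniqueness_of_boundedEnstrophy hB).1,
    tao_unconditional_uniqueness_velocity_of_boundedEnstrophy hB,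
    (tao_unconditional_uniqueness_of_boundedEnstrophy hB).2⟩

end Literature.Analysis.FluidPDE

end
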